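import Literature.NumberTheory.Automorphic.UnitaryConjugacyCompactModStabilizerWindow   -- ⊙ W1 (field level): `exists_window_isCompact_conj_mem_imp_mulVec_eq`
import Literature.NumberTheory.Rogawski1990.LocalEndoscopicCompactModCentralizerCM       -- ★ p841655 (box version): the one-place-model plumbing imports, ★ A1 frame facts
import Literature.NumberTheory.Rogawski1990.LocalNormFibreNonsplit                       -- ★ `IsLocalStablyConjH.snd_eq` (+ ★ `LocalTransfer`: `IsLocalStablyConjH`, ★ `endoEmbLocal`)
import HarnessLib

/-!
# «COMPACT MODULO `Z(ε)`» UNIFORMLY ON A STABLY SATURATED NEIGHBOURHOOD OF THE CENTRAL POINT `ε_H = (a·1₂, u)` — the WINDOW version of ★ p841655 along the central dock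
# (N6nsGerm (S1), binder `hD` of the (R-inv) junction ★ `exists_nhds_stableOrbitalIntegralRel_eq_of_central_singular_inv`; p08 (g13)'s census «B4-meas» §4 (r4) — FILE W2)

Topic `NumberTheory/Rogawski1990`; namespace `Literature.NumberTheory.Rogawski1990`.  KERNEL mathematics only: one theorem (+ private helpers), no definition, no named fact, no
instance, no notation, no `sorry`.  Cell `pub/hodgecm-mathlib` (D-0151), crux H413 = stmt-HodgeConjecture-24833, floor-2 line «N6nsGerm», stub `stub_N6nsS1`; LEAD F0P3a-plan (g9)
T8-38 (1) ∕ T8-87; consumer p08 (g13)'s M3 `LocalTransferCentralSingularDescentCM` (Harish-Chandra's `β`-cut-off descent read on a STABLY SATURATED `B ∋ ε_H`).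

THE STATEMENT.  `v` non-split (`w ∣ v`, `w̄ = w`), `H′` hermitian with `det H′ ≠ 0`, `ε_H = (a·1₂, u) ∈ H_v = U(Φ₂)_v × U(Φ₁)_v` with `u ≠ a`, and the central dock `θ : H_v ≃ₜ* Z_{G′_v}(ε)`,
`θ ε_H = ε`, `(θ z) = y·ι_v(z)·y⁻¹` (★ `exists_centralDock_of_fst_eq_smul_one`).  Then there is `B ∈ 𝓝 ε_H`, STABLY SATURATED (`h ∈ B`, `h ∼_st h′` ⇒ `h′ ∈ B`), such that for every
compact `Ω ⊆ G′_v` some compact `C ⊆ G′_v` has: `x·θ(h)·x⁻¹ ∈ Ω` with `h ∈ B` ⇒ `x ∈ C · Z(ε)`.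
THE WINDOW.  `B := {h ∣ the coefficients of χ_{ι_v h} (read in L_w) are within ρ of those of (X − a)²(X − u), and ‖u(h) − u‖_w ≤ r}` with `ρ, r` from ⊙ W1 — cut out by STABLE
invariants (`χ_{ι h}`: stable conjugacy in `H_v` is componentwise `GL`-conjugacy ★ `IsStablyConj`, and `ι = endoGL` is multiplicative; `u(h)`: ★ `IsLocalStablyConjH.snd_eq`), a
neighbourhood by continuity (finitely many coefficients).
PROOF = ⊙ W1 at the one-place image (`φ = localNonsplitEquiv`, frame `P := y` read in `L_w`, `e := endoPerm`, `v₁ := y·e₂` — every `θ h` has `y·e₂` as `u(h)`-eigenvector since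
`ι(h) e₂ = u(h) e₂`; anisotropy ★ A1 `hermForm_frameVec_ne_zero`), then `Stab(v₁) ≤ Z(φ ε)` (★ A1 `commute_of_mulVec_frameVec_eq`) and transport back along `φ⁻¹` as in ★ p841655.

* **`exists_nhds_stablySaturated_conj_mem_imp_mem_mul_centralizer`**.

HONEST SCOPE.  HC_CM is proved only modulo the printed citations until rung 0 closes; this file discharges no printed statement (it pays the topological half of ONE binder).

## References
* [HarishChandra1970] Harish-Chandra (notes by G. van Dijk), *Harmonic Analysis on Reductive p-adic Groups*, LNM 162 (1970), Part I §3 Lemma 19 + Corollary; Part II §5.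
* [Rogawski1990] J. D. Rogawski, *Automorphic Representations of Unitary Groups in Three Variables*, Ann. of Math. Stud. 123 (1990), §8.2 Prop. 8.2.1 pp. 112–116; §4.8–4.9 pp. 53–55.
* [LanglandsShelstad1990Descent] R. P. Langlands, D. Shelstad, *Descent for transfer factors*, The Grothendieck Festschrift II (1990), §2.4 (invariant neighbourhoods).
* [PlatonovRapinchuk1994] V. Platonov, A. Rapinchuk, *Algebraic Groups and Number Theory* (1994), §5.1 (the one-place model).
-/

set_option autoImplicit false

noncomputable section

open Set Filter Topology Polynomial NumberField IsDedekindDomain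
open Literature.NumberTheory.Automorphic Literature.NumberTheory.Automorphic.UnitaryGroup Literature.Analysis.Calculus Literature.LinearAlgebra.Matrix
open scoped Matrix MatrixGroups Pointwise

namespace Literature.NumberTheory.Rogawski1990

variable (L : Type) [Field L] [NumberField L] [IsCMField L] {v : HeightOneSpectrum (𝓞 ↥(maximalRealSubfield L))}

section CompactModCentralizerWindow

variable (H' : Matrix (Fin 3) (Fin 3) L)

/-- `conjLocal` at the unique place above a non-split `v` is the Galois transport `c_w` on that factor. [cite: PlatonovRapinchuk1994, §5.1] -/
private theorem conjLocal_apply_of_smul_eq'' (w : PlacesOver L v) (hw : IsCMField.complexConj L • w.1 = w.1) (x : LocalRing L v) :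
    UnitaryGroup.conjLocal L (IsCMField.complexConj L) v x w = galAdicCompletionMap (L := L) (IsCMField.complexConj L) hw (x w) := by
  have key : ∀ (w₁ : PlacesOver L v) (h₁ : IsCMField.complexConj L • w₁.1 = w.1),
      galAdicCompletionMap (L := L) (IsCMField.complexConj L) h₁ (x w₁) = galAdicCompletionMap (L := L) (IsCMField.complexConj L) hw (x w) := by
    intro w₁ h₁
    have e : w₁ = w := PlacesOver.eq_of_smul_eq (IsCMField.complexConj L) (IsCMField.complexConj_ne_one L) w hw w₁
    subst e
    rfl
  rw [UnitaryGroup.conjLocal_apply]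
  exact key ⟨(IsCMField.complexConj L)⁻¹ • w.1, UnitaryGroup.under_inv_smul_eq (IsCMField.complexConj L) w⟩ (smul_inv_smul (IsCMField.complexConj L) w.1)

omit [IsCMField L] in
/-- The local form of `Φ₁ = (1)` is `(1)`. [cite: Rogawski1990, §4.8 Case (a) p. 53] -/
private theorem localFormOne_apply' :
    UnitaryGroup.adeleToLocal L v (UnitaryGroup.adelicForm L 1 (Matrix.of fun i j : Fin 1 => if i.val + j.val + 1 = 1 then (1 : L) else 0) 0 0) = 1 := by
  rw [UnitaryGroup.adelicForm, Matrix.map_apply, Matrix.of_apply]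
  simp

/-- **`σ(u) · u = 1`** for the entry `u` of an element of the `1 × 1` unitary group `U(Φ₁)_v`. [cite: Rogawski1990, §4.8 Case (a) p. 53; §4.9 p. 55] -/
private theorem conjLocal_entry_mul_entry (g : (cmDatum L 1 (Matrix.of fun i j : Fin 1 => if i.val + j.val + 1 = 1 then (1 : L) else 0)).Local v) :
    UnitaryGroup.conjLocal L (IsCMField.complexConj L) v ((g.val.val : Matrix (Fin 1) (Fin 1) (LocalRing L v)) 0 0) *
      (g.val.val : Matrix (Fin 1) (Fin 1) (LocalRing L v)) 0 0 = 1 := by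
  have hmem : ((g.val.val : Matrix (Fin 1) (Fin 1) (LocalRing L v)).map (UnitaryGroup.conjLocal L (IsCMField.complexConj L) v))ᵀ *
      (UnitaryGroup.adelicForm L 1 (Matrix.of fun i j : Fin 1 => if i.val + j.val + 1 = 1 then (1 : L) else 0)).map (UnitaryGroup.adeleToLocal L v) *
      (g.val.val : Matrix (Fin 1) (Fin 1) (LocalRing L v)) =
      (UnitaryGroup.adelicForm L 1 (Matrix.of fun i j : Fin 1 => if i.val + j.val + 1 = 1 then (1 : L) else 0)).map (UnitaryGroup.adeleToLocal L v) :=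
    mem_unitaryGroupOfForm_iff.mp g.2
  have h00 := congrFun (congrFun hmem 0) 0
  simp only [Matrix.mul_apply, Fin.sum_univ_one, Matrix.transpose_apply, Matrix.map_apply, localFormOne_apply', mul_one] at h00
  exact h00

set_option maxHeartbeats 1000000 in
/-- **COMPACT MODULO `Z(ε)` ON A STABLY SATURATED NEIGHBOURHOOD OF `ε_H` (the window version of ★ p841655, along the central dock).**  See the module docstring.
[cite: HarishChandra1970, Part I §3 Lemma 19 + Corollary; Part II §5] [cite: Rogawski1990, §8.2 Prop. 8.2.1 pp. 112–116] [cite: LanglandsShelstad1990Descent, §2.4]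
[cite: PlatonovRapinchuk1994, §5.1] -/
theorem exists_nhds_stablySaturated_conj_mem_imp_mem_mul_centralizer (hH' : (H'.map (cmConjRingHom L))ᵀ = H') (hdet' : H'.det ≠ 0)
    (w : PlacesOver L v) (hw : IsCMField.complexConj L • w.1 = w.1)
    (εH : ((cmDatum L 2 (Matrix.of fun i j : Fin 2 => if i.val + j.val + 1 = 2 then (1 : L) else 0)).Local v ×
      (cmDatum L 1 (Matrix.of fun i j : Fin 1 => if i.val + j.val + 1 = 1 then (1 : L) else 0)).Local v)) (a : LocalRing L v)
    (ha : (εH.1.val.val : Matrix (Fin 2) (Fin 2) (LocalRing L v)) = a • (1 : Matrix (Fin 2) (Fin 2) (LocalRing L v)))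
    (hu : (εH.2.val.val : Matrix (Fin 1) (Fin 1) (LocalRing L v)) 0 0 ≠ a)
    (ε : ((cmDatum L 3 H').Local v)) (y : GL (Fin 3) (LocalRing L v)) (θ : ((cmDatum L 2 (Matrix.of fun i j : Fin 2 => if i.val + j.val + 1 = 2 then (1 : L) else 0)).Local v ×
      (cmDatum L 1 (Matrix.of fun i j : Fin 1 => if i.val + j.val + 1 = 1 then (1 : L) else 0)).Local v) ≃ₜ* ↥(Subgroup.centralizer ({ε} : Set ((cmDatum L 3 H').Local v)))) (hθε : (θ εH).1 = ε)
    (hθ : ∀ z : ((cmDatum L 2 (Matrix.of fun i j : Fin 2 => if i.val + j.val + 1 = 2 then (1 : L) else 0)).Local v ×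
      (cmDatum L 1 (Matrix.of fun i j : Fin 1 => if i.val + j.val + 1 = 1 then (1 : L) else 0)).Local v), (((θ z).1).val : GL (Fin 3) (LocalRing L v)) = y * ((endoEmbLocal L v z).val : GL (Fin 3) (LocalRing L v)) * y⁻¹) :
    ∃ B ∈ 𝓝 εH, (∀ h ∈ B, ∀ h' : ((cmDatum L 2 (Matrix.of fun i j : Fin 2 => if i.val + j.val + 1 = 2 then (1 : L) else 0)).Local v ×
      (cmDatum L 1 (Matrix.of fun i j : Fin 1 => if i.val + j.val + 1 = 1 then (1 : L) else 0)).Local v), IsLocalStablyConjH L v h h' → h' ∈ B) ∧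
      ∀ Ω : Set ((cmDatum L 3 H').Local v), IsCompact Ω → ∃ C : Set ((cmDatum L 3 H').Local v), IsCompact C ∧
        ∀ x : ((cmDatum L 3 H').Local v), ∀ h ∈ B, x * ((θ h : ↥(Subgroup.centralizer ({ε} : Set ((cmDatum L 3 H').Local v)))) : ((cmDatum L 3 H').Local v)) * x⁻¹ ∈ Ω → x ∈ C * (Subgroup.centralizer ({ε} : Set ((cmDatum L 3 H').Local v)) : Set ((cmDatum L 3 H').Local v)) := by
  classical
  letI : Unique (PlacesOver L v) :=
    @uniqueOfSubsingleton _ (PlacesOver.subsingleton_of_smul_eq (IsCMField.complexConj L) (IsCMField.complexConj_ne_one L) w hw) w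
  -- `L_w`: complete proper non-trivially normed field of characteristic zero; `c_w` a continuous isometric involution; `H′_w` hermitian non-degenerate
  letI : NontriviallyNormedField (w.1.adicCompletion L) := Valued.toNontriviallyNormedField (w.1.adicCompletion L) (WithZero (Multiplicative ℤ))
  haveI : ProperSpace (w.1.adicCompletion L) := properSpace_adicCompletion L w.1
  haveI : CharZero (w.1.adicCompletion L) := charZero_of_injective_algebraMap (algebraMap L _).injective
  have hσc := continuous_galAdicCompletionMap L (IsCMField.complexConj L) hw
  have hσσ : ∀ s, galAdicCompletionMap (L := L) (IsCMField.complexConj L) hw (galAdicCompletionMap (L := L) (IsCMField.complexConj L) hw s) = s :=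
    galAdicCompletionMap_galAdicCompletionMap_of_smul_eq (IsCMField.complexConj L) w (IsCMField.complexConj_ne_one L) hw
  have hσi : ∀ s : w.1.adicCompletion L, ‖galAdicCompletionMap (L := L) (IsCMField.complexConj L) hw s‖ = ‖s‖ := fun s =>
    le_antisymm (Valued.toNormedField.norm_le_iff.2 (by rw [valued_galAdicCompletionMap]))
      (Valued.toNormedField.norm_le_iff.2 (by rw [valued_galAdicCompletionMap]))
  have hHc : (H'.map (IsCMField.complexConj L))ᵀ = H' := by rw [← map_cmConjRingHom_eq_map_complexConj]; exact hH'
  have hJw : ((placeForm H' w.1).map (galAdicCompletionMap (L := L) (IsCMField.complexConj L) hw))ᵀ = placeForm H' w.1 :=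
    placeForm_hermitian_of_smul_eq (IsCMField.complexConj L) w H' hHc hw
  have hJd : (placeForm H' w.1).det ≠ 0 := ((Matrix.isUnit_iff_isUnit_det _).1 (isUnit_placeForm_of_isUnit_det (Ne.isUnit hdet') w.1)).ne_zero
  have h2 : (2 : w.1.adicCompletion L) ≠ 0 := two_ne_zero
  set φ := localNonsplitEquiv (IsCMField.complexConj L) H' (IsCMField.complexConj_ne_one L) w hw with hφ
  set ψ : LocalRing L v →+* w.1.adicCompletion L := Pi.evalRingHom (fun w' : PlacesOver L v => w'.1.adicCompletion L) w with hψdef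
  have hψinj : Function.Injective ψ := by
    have hψ' : ψ = (RingEquiv.piUnique fun w' : PlacesOver L v => w'.1.adicCompletion L).toRingHom := RingHom.ext fun _ => rfl
    rw [hψ']
    exact (RingEquiv.piUnique fun w' : PlacesOver L v => w'.1.adicCompletion L).injective
  have hψc : Continuous ψ := continuous_apply w
  have hmat : ∀ g : ((cmDatum L 3 H').Local v), (((φ g : ↥(unitaryGroupOfForm (galAdicCompletionMap (L := L) (IsCMField.complexConj L) hw) (placeForm H' w.1))) : GL (Fin 3) (w.1.adicCompletion L)) : Matrix (Fin 3) (Fin 3) (w.1.adicCompletion L)) =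
      (g.val.val : Matrix (Fin 3) (Fin 3) (LocalRing L v)).map ψ := fun _ => rfl
  have hsmul : ∀ (k : ℕ) (c : LocalRing L v), (c • (1 : Matrix (Fin k) (Fin k) (LocalRing L v))).map ψ = ψ c • (1 : Matrix (Fin k) (Fin k) (w.1.adicCompletion L)) :=
    fun k c => by rw [Matrix.smul_one_eq_diagonal, Matrix.diagonal_map (map_zero ψ), Matrix.smul_one_eq_diagonal]
  -- the `U(Φ₁)` entry of `ε_H` and its unitarity in `L_w`
  set u₀ : LocalRing L v := (εH.2.val.val : Matrix (Fin 1) (Fin 1) (LocalRing L v)) 0 0 with hu₀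
  have hau' : ψ a ≠ ψ u₀ := fun h => hu (hψinj h).symm
  have hunit : ∀ g : (cmDatum L 1 (Matrix.of fun i j : Fin 1 => if i.val + j.val + 1 = 1 then (1 : L) else 0)).Local v,
      ψ ((g.val.val : Matrix (Fin 1) (Fin 1) (LocalRing L v)) 0 0) * galAdicCompletionMap (L := L) (IsCMField.complexConj L) hw (ψ ((g.val.val : Matrix (Fin 1) (Fin 1) (LocalRing L v)) 0 0)) = 1 := by
    intro g
    have h := congrArg ψ (conjLocal_entry_mul_entry L g)
    rw [map_mul, map_one] at h
    have h' : ψ (UnitaryGroup.conjLocal L (IsCMField.complexConj L) v ((g.val.val : Matrix (Fin 1) (Fin 1) (LocalRing L v)) 0 0)) =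
        galAdicCompletionMap (L := L) (IsCMField.complexConj L) hw (ψ ((g.val.val : Matrix (Fin 1) (Fin 1) (LocalRing L v)) 0 0)) :=
      conjLocal_apply_of_smul_eq'' L w hw _
    rw [h', mul_comm] at h
    exact h
  have hu1' : ψ u₀ * galAdicCompletionMap (L := L) (IsCMField.complexConj L) hw (ψ u₀) = 1 := hunit εH.2
  -- the `1 × 1` block is the scalar `u(h)`
  have hD : ∀ h : ((cmDatum L 2 (Matrix.of fun i j : Fin 2 => if i.val + j.val + 1 = 2 then (1 : L) else 0)).Local v ×
      (cmDatum L 1 (Matrix.of fun i j : Fin 1 => if i.val + j.val + 1 = 1 then (1 : L) else 0)).Local v), (h.2.val.val : Matrix (Fin 1) (Fin 1) (LocalRing L v)) = ((h.2.val.val : Matrix (Fin 1) (Fin 1) (LocalRing L v)) 0 0) • (1 : Matrix (Fin 1) (Fin 1) (LocalRing L v)) := by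
    intro h
    ext i j
    have hi : i = 0 := Subsingleton.elim _ _
    have hj : j = 0 := Subsingleton.elim _ _
    subst hi; subst hj
    rw [Matrix.smul_apply, Matrix.one_apply_eq, smul_eq_mul, mul_one]
  -- the frame in the one-place model: `P := y`, `e := endoPerm`
  have hιε : ((endoEmbLocal L v εH).val.val : Matrix (Fin 3) (Fin 3) (LocalRing L v)) =
      Matrix.reindex endoPerm endoPerm (Matrix.fromBlocks (a • (1 : Matrix (Fin 2) (Fin 2) (LocalRing L v))) 0 0 (u₀ • (1 : Matrix (Fin 1) (Fin 1) (LocalRing L v)))) := by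
    rw [coe_endoEmbLocal, coe_endoGL, ← ha, ← hD εH]
  have hεy : (ε.val : GL (Fin 3) (LocalRing L v)) * y = y * ((endoEmbLocal L v εH).val : GL (Fin 3) (LocalRing L v)) := by
    have h := hθ εH
    rw [hθε] at h
    rw [h, inv_mul_cancel_right]
  set Pm : GL (Fin 3) (w.1.adicCompletion L) := Matrix.GeneralLinearGroup.map ψ y with hPm
  have hP : (((φ ε : ↥(unitaryGroupOfForm (galAdicCompletionMap (L := L) (IsCMField.complexConj L) hw) (placeForm H' w.1))) : GL (Fin 3) (w.1.adicCompletion L)) : Matrix (Fin 3) (Fin 3) (w.1.adicCompletion L)) * Pm.val =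
      Pm.val * Matrix.reindex endoPerm endoPerm
        (Matrix.fromBlocks (ψ a • (1 : Matrix (Fin 2) (Fin 2) (w.1.adicCompletion L))) 0 0 (ψ u₀ • (1 : Matrix (Fin 1) (Fin 1) (w.1.adicCompletion L)))) := by
    have h := congrArg (fun g : GL (Fin 3) (LocalRing L v) => g.val.map ψ) hεy
    simp only [Units.val_mul, Matrix.map_mul] at h
    rw [hιε, Matrix.reindex_apply, ← Matrix.submatrix_map, Matrix.fromBlocks_map, hsmul, hsmul, Matrix.map_zero ψ (map_zero ψ), Matrix.map_zero ψ (map_zero ψ)] at h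
    rw [hmat, Matrix.reindex_apply]
    exact h
  have hβ := hermForm_frameVec_ne_zero (galAdicCompletionMap (L := L) (IsCMField.complexConj L) hw) (placeForm H' w.1) hJd (φ ε).2 hP hau' hu1'
  -- ⊙ W1 at the one-place image
  obtain ⟨ρ, hρ, r, hr, hmain⟩ := exists_window_isCompact_conj_mem_imp_mulVec_eq (galAdicCompletionMap (L := L) (IsCMField.complexConj L) hw) (placeForm H' w.1)
    hσσ hσc hσi hJw hJd h2 hβ hau' (k := 2) (by rw [Fintype.card_fin])
  -- the window `B`
  set χ₀ : (w.1.adicCompletion L)[X] := (X - Polynomial.C (ψ a)) ^ 2 * (X - Polynomial.C (ψ u₀)) with hχ₀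
  let cH : ((cmDatum L 2 (Matrix.of fun i j : Fin 2 => if i.val + j.val + 1 = 2 then (1 : L) else 0)).Local v ×
      (cmDatum L 1 (Matrix.of fun i j : Fin 1 => if i.val + j.val + 1 = 1 then (1 : L) else 0)).Local v) → ℕ → w.1.adicCompletion L := fun h i =>
    (((endoEmbLocal L v h).val.val : Matrix (Fin 3) (Fin 3) (LocalRing L v)).map ψ).charpoly.coeff i
  let uH : ((cmDatum L 2 (Matrix.of fun i j : Fin 2 => if i.val + j.val + 1 = 2 then (1 : L) else 0)).Local v ×
      (cmDatum L 1 (Matrix.of fun i j : Fin 1 => if i.val + j.val + 1 = 1 then (1 : L) else 0)).Local v) → w.1.adicCompletion L := fun h => ψ ((h.2.val.val : Matrix (Fin 1) (Fin 1) (LocalRing L v)) 0 0)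
  set B : Set ((cmDatum L 2 (Matrix.of fun i j : Fin 2 => if i.val + j.val + 1 = 2 then (1 : L) else 0)).Local v ×
      (cmDatum L 1 (Matrix.of fun i j : Fin 1 => if i.val + j.val + 1 = 1 then (1 : L) else 0)).Local v) := {h | (∀ i : Fin (Fintype.card (Fin 3) + 1), ‖cH h i - χ₀.coeff i‖ ≤ ρ) ∧ ‖uH h - ψ u₀‖ ≤ r} with hB
  have hcHc : ∀ i : ℕ, Continuous fun h : ((cmDatum L 2 (Matrix.of fun i j : Fin 2 => if i.val + j.val + 1 = 2 then (1 : L) else 0)).Local v ×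
      (cmDatum L 1 (Matrix.of fun i j : Fin 1 => if i.val + j.val + 1 = 1 then (1 : L) else 0)).Local v) => cH h i := fun i =>
    (continuous_charpoly_coeff i).comp ((((Units.continuous_val.comp continuous_subtype_val).comp (continuous_endoEmbLocal L v))).matrix_map hψc)
  have huHc : Continuous uH :=
    hψc.comp (((Units.continuous_val.comp continuous_subtype_val).comp continuous_snd).matrix_elem 0 0)
  -- at `ε_H` the window data are `(χ₀, u)`
  have hχεH : (((endoEmbLocal L v εH).val.val : Matrix (Fin 3) (Fin 3) (LocalRing L v)).map ψ).charpoly = χ₀ := by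
    rw [hιε, Matrix.reindex_apply, ← Matrix.submatrix_map, Matrix.fromBlocks_map, hsmul, hsmul, Matrix.map_zero ψ (map_zero ψ), Matrix.map_zero ψ (map_zero ψ),
      ← Matrix.reindex_apply, Matrix.charpoly_reindex, Matrix.charpoly_fromBlocks_zero₁₂, Matrix.smul_one_eq_diagonal, Matrix.charpoly_diagonal,
      Matrix.smul_one_eq_diagonal, Matrix.charpoly_diagonal, Finset.prod_const, Finset.card_univ, Fintype.card_fin, Finset.prod_const, Finset.card_univ,
      Fintype.card_fin, pow_one]
  have hBnhds : B ∈ 𝓝 εH := by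
    have hO : IsOpen ((⋂ i : Fin (Fintype.card (Fin 3) + 1), {h : ((cmDatum L 2 (Matrix.of fun i j : Fin 2 => if i.val + j.val + 1 = 2 then (1 : L) else 0)).Local v ×
      (cmDatum L 1 (Matrix.of fun i j : Fin 1 => if i.val + j.val + 1 = 1 then (1 : L) else 0)).Local v) | ‖cH h i - χ₀.coeff i‖ < ρ}) ∩ {h : ((cmDatum L 2 (Matrix.of fun i j : Fin 2 => if i.val + j.val + 1 = 2 then (1 : L) else 0)).Local v ×
      (cmDatum L 1 (Matrix.of fun i j : Fin 1 => if i.val + j.val + 1 = 1 then (1 : L) else 0)).Local v) | ‖uH h - ψ u₀‖ < r}) :=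
      (isOpen_iInter_of_finite fun i : Fin (Fintype.card (Fin 3) + 1) => isOpen_lt (((hcHc i).sub continuous_const).norm) continuous_const).inter
        (isOpen_lt ((huHc.sub continuous_const).norm) continuous_const)
    refine mem_of_superset (hO.mem_nhds ⟨Set.mem_iInter.2 fun i => ?_, ?_⟩) fun h hh => ⟨fun i => le_of_lt (Set.mem_iInter.1 hh.1 i), le_of_lt hh.2⟩
    · show ‖cH εH i - χ₀.coeff i‖ < ρ
      have : cH εH i = χ₀.coeff i := by show (((endoEmbLocal L v εH).val.val : Matrix (Fin 3) (Fin 3) (LocalRing L v)).map ψ).charpoly.coeff i = _; rw [hχεH]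
      rw [this, sub_self, norm_zero]; exact hρ
    · show ‖uH εH - ψ u₀‖ < r
      rw [show uH εH = ψ u₀ from rfl, sub_self, norm_zero]; exact hr
  -- `B` is stably saturated: `χ_{ι h}` and `u(h)` are stable invariants
  have hBsat : ∀ h ∈ B, ∀ h' : ((cmDatum L 2 (Matrix.of fun i j : Fin 2 => if i.val + j.val + 1 = 2 then (1 : L) else 0)).Local v ×
      (cmDatum L 1 (Matrix.of fun i j : Fin 1 => if i.val + j.val + 1 = 1 then (1 : L) else 0)).Local v), IsLocalStablyConjH L v h h' → h' ∈ B := by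
    rintro h ⟨hc, hur⟩ h' hst
    have h2eq : h.2 = h'.2 := hst.snd_eq L v
    have hχ : (((endoEmbLocal L v h').val.val : Matrix (Fin 3) (Fin 3) (LocalRing L v))).charpoly =
        (((endoEmbLocal L v h).val.val : Matrix (Fin 3) (Fin 3) (LocalRing L v))).charpoly := by
      obtain ⟨c, hcc⟩ := isConj_iff.1 hst.1
      have hGL : ((endoEmbLocal L v h').val : GL (Fin 3) (LocalRing L v)) =
          endoGL (c, 1) * ((endoEmbLocal L v h).val : GL (Fin 3) (LocalRing L v)) * (endoGL (c, 1))⁻¹ := by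
        rw [coe_endoEmbLocal, coe_endoEmbLocal, ← map_inv, ← map_mul, ← map_mul, Prod.inv_mk, inv_one, Prod.mk_mul_mk, Prod.mk_mul_mk, one_mul, mul_one,
          hcc, h2eq]
      rw [hGL, Units.val_mul, Units.val_mul, Matrix.coe_units_inv, Matrix.charpoly_units_conj]
    refine ⟨fun i => ?_, by show ‖ψ ((h'.2.val.val : Matrix (Fin 1) (Fin 1) (LocalRing L v)) 0 0) - ψ u₀‖ ≤ r; rw [← h2eq]; exact hur⟩
    show ‖(((endoEmbLocal L v h').val.val : Matrix (Fin 3) (Fin 3) (LocalRing L v)).map ψ).charpoly.coeff i - χ₀.coeff i‖ ≤ ρ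
    rw [Matrix.charpoly_map, hχ, ← Matrix.charpoly_map]
    exact hc i
  refine ⟨B, hBnhds, hBsat, fun Ω hΩ => ?_⟩
  -- push `Ω` forward, pull `C` back
  have hφc : Continuous fun g : ((cmDatum L 3 H').Local v) => (((φ g : ↥(unitaryGroupOfForm (galAdicCompletionMap (L := L) (IsCMField.complexConj L) hw) (placeForm H' w.1))) : GL (Fin 3) (w.1.adicCompletion L)) : Matrix (Fin 3) (Fin 3) (w.1.adicCompletion L)) :=
    (Units.continuous_val.comp continuous_subtype_val).comp φ.continuous
  obtain ⟨C', hCc', hC'⟩ := hmain _ (hΩ.image hφc)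
  refine ⟨(φ.symm : ↥(unitaryGroupOfForm (galAdicCompletionMap (L := L) (IsCMField.complexConj L) hw) (placeForm H' w.1)) → ((cmDatum L 3 H').Local v)) '' C', hCc'.image φ.symm.continuous, fun x h hhB hxt => ?_⟩
  obtain ⟨hc, hur⟩ := hhB
  set t : ((cmDatum L 3 H').Local v) := (θ h : ↥(Subgroup.centralizer ({ε} : Set ((cmDatum L 3 H').Local v)))).1 with ht
  set uh : LocalRing L v := (h.2.val.val : Matrix (Fin 1) (Fin 1) (LocalRing L v)) 0 0 with huh
  -- `t = y ι(h) y⁻¹`: eigenvector `y e₂` with eigenvalue `u(h)`, characteristic polynomial `χ_{ι h}`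
  have htGL : (t.val : GL (Fin 3) (LocalRing L v)) = y * ((endoEmbLocal L v h).val : GL (Fin 3) (LocalRing L v)) * y⁻¹ := hθ h
  have hty : (t.val.val : Matrix (Fin 3) (Fin 3) (LocalRing L v)) * (y.val : Matrix (Fin 3) (Fin 3) (LocalRing L v)) =
      (y.val : Matrix (Fin 3) (Fin 3) (LocalRing L v)) * ((endoEmbLocal L v h).val.val : Matrix (Fin 3) (Fin 3) (LocalRing L v)) := by
    have h1 : (t.val : GL (Fin 3) (LocalRing L v)) * y = y * ((endoEmbLocal L v h).val : GL (Fin 3) (LocalRing L v)) := by rw [htGL, inv_mul_cancel_right]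
    have h2 := congrArg (fun g : GL (Fin 3) (LocalRing L v) => g.val) h1
    simp only [Units.val_mul] at h2
    exact h2
  have hcol : (((endoEmbLocal L v h).val.val : Matrix (Fin 3) (Fin 3) (LocalRing L v)).map ψ) *ᵥ Pi.single (endoPerm (Sum.inr 0)) (1 : w.1.adicCompletion L) =
      ψ uh • Pi.single (endoPerm (Sum.inr 0)) (1 : w.1.adicCompletion L) := by
    rw [endoPerm_inr_zero, Matrix.mulVec_single_one, coe_endoEmbLocal, coe_endoGL_eq]
    ext i
    fin_cases i <;> simp [Matrix.col_apply, huh]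
  have htv : (((φ t : ↥(unitaryGroupOfForm (galAdicCompletionMap (L := L) (IsCMField.complexConj L) hw) (placeForm H' w.1))) : GL (Fin 3) (w.1.adicCompletion L)) : Matrix (Fin 3) (Fin 3) (w.1.adicCompletion L)) *ᵥ (Pm.val *ᵥ Pi.single (endoPerm (Sum.inr 0)) 1) =
      ψ uh • (Pm.val *ᵥ Pi.single (endoPerm (Sum.inr 0)) 1) := by
    rw [hmat, show (Pm.val : Matrix (Fin 3) (Fin 3) (w.1.adicCompletion L)) = (y.val : Matrix (Fin 3) (Fin 3) (LocalRing L v)).map ψ from rfl, Matrix.mulVec_mulVec,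
      ← Matrix.map_mul, hty, Matrix.map_mul, ← Matrix.mulVec_mulVec, hcol, Matrix.mulVec_smul]
  have hχt : ((((φ t : ↥(unitaryGroupOfForm (galAdicCompletionMap (L := L) (IsCMField.complexConj L) hw) (placeForm H' w.1))) : GL (Fin 3) (w.1.adicCompletion L)) : Matrix (Fin 3) (Fin 3) (w.1.adicCompletion L))).charpoly =
      (((endoEmbLocal L v h).val.val : Matrix (Fin 3) (Fin 3) (LocalRing L v)).map ψ).charpoly := by
    rw [hmat, Matrix.charpoly_map, Matrix.charpoly_map, htGL, Units.val_mul, Units.val_mul, Matrix.coe_units_inv, Matrix.charpoly_units_conj]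
  have hcoef : ∀ i : Fin (Fintype.card (Fin 3) + 1),
      ‖((((φ t : ↥(unitaryGroupOfForm (galAdicCompletionMap (L := L) (IsCMField.complexConj L) hw) (placeForm H' w.1))) : GL (Fin 3) (w.1.adicCompletion L)) : Matrix (Fin 3) (Fin 3) (w.1.adicCompletion L))).charpoly.coeff i - χ₀.coeff i‖ ≤ ρ := fun i => by
    rw [hχt]; exact hc i
  -- membership of the conjugate in the image of `Ω`
  have h2' : φ (x * t) = φ x * φ t := map_mul φ _ _
  have h1' : φ (x * t * x⁻¹) = φ (x * t) * φ x⁻¹ := map_mul φ _ _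
  have h3' : φ x⁻¹ = (φ x)⁻¹ := map_inv φ _
  have hconj : φ x * φ t * (φ x)⁻¹ = φ (x * t * x⁻¹) := by rw [h1', h2', h3']
  have hmemΩ : ((((φ x * φ t * (φ x)⁻¹ : ↥(unitaryGroupOfForm (galAdicCompletionMap (L := L) (IsCMField.complexConj L) hw) (placeForm H' w.1)))) : GL (Fin 3) (w.1.adicCompletion L)) : Matrix (Fin 3) (Fin 3) (w.1.adicCompletion L)) ∈
      (fun g : ((cmDatum L 3 H').Local v) => (((φ g : ↥(unitaryGroupOfForm (galAdicCompletionMap (L := L) (IsCMField.complexConj L) hw) (placeForm H' w.1))) : GL (Fin 3) (w.1.adicCompletion L)) : Matrix (Fin 3) (Fin 3) (w.1.adicCompletion L))) '' Ω :=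
    ⟨x * t * x⁻¹, hxt, by rw [hconj]⟩
  obtain ⟨c', hc'C, hcv⟩ := hC' (φ x) (φ t) (ψ uh) hur (hunit h.2) htv hcoef hmemΩ
  -- `Stab(v₁) ≤ Z(φ ε)` (★ A1), then back along `φ⁻¹`
  have hcomm := commute_of_mulVec_frameVec_eq (galAdicCompletionMap (L := L) (IsCMField.complexConj L) hw) (placeForm H' w.1) hJd (φ ε).2 hP hau' hu1'
    (c'⁻¹ * φ x).2 hcv
  have hz : (c'⁻¹ * φ x : ↥(unitaryGroupOfForm (galAdicCompletionMap (L := L) (IsCMField.complexConj L) hw) (placeForm H' w.1))) * φ ε = φ ε * (c'⁻¹ * φ x) := Subtype.ext (Units.ext hcomm.eq)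
  have hzmem : (c'⁻¹ * φ x : ↥(unitaryGroupOfForm (galAdicCompletionMap (L := L) (IsCMField.complexConj L) hw) (placeForm H' w.1))) ∈ Subgroup.centralizer ({φ ε} : Set ↥(unitaryGroupOfForm (galAdicCompletionMap (L := L) (IsCMField.complexConj L) hw) (placeForm H' w.1))) := Subgroup.mem_centralizer_singleton_iff.2 hz
  obtain ⟨κ, hκ⟩ := exists_homeomorph_centralizer_map φ ε (φ ε) rfl
  have hcoe : ((κ.symm ⟨c'⁻¹ * φ x, hzmem⟩).1 : ((cmDatum L 3 H').Local v)) = φ.symm (c'⁻¹ * φ x) := by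
    have h := hκ (κ.symm ⟨c'⁻¹ * φ x, hzmem⟩)
    rw [κ.apply_symm_apply] at h
    have h' := congrArg φ.symm h
    rw [φ.symm_apply_apply] at h'
    exact h'.symm
  have hz' : (φ.symm (c'⁻¹ * φ x) : ((cmDatum L 3 H').Local v)) ∈ Subgroup.centralizer ({ε} : Set ((cmDatum L 3 H').Local v)) := by
    rw [← hcoe]
    exact (κ.symm ⟨c'⁻¹ * φ x, hzmem⟩).2
  have hfin : (φ.symm c' : ((cmDatum L 3 H').Local v)) * φ.symm (c'⁻¹ * φ x) = x := by
    have h4 : φ.symm (c' * (c'⁻¹ * φ x)) = φ.symm c' * φ.symm (c'⁻¹ * φ x) := map_mul φ.symm _ _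
    have h5 : c' * (c'⁻¹ * φ x) = φ x := mul_inv_cancel_left c' (φ x)
    have h6 : φ.symm (φ x) = x := φ.symm_apply_apply x
    exact h4.symm.trans ((congrArg φ.symm h5).trans h6)
  exact Set.mem_mul.2 ⟨φ.symm c', ⟨c', hc'C, rfl⟩, φ.symm (c'⁻¹ * φ x), hz', hfin⟩

end CompactModCentralizerWindow

end Literature.NumberTheory.Rogawski1990
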